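import Summits.CriticalPhenomena.Ising3D.IsingColumnFaceL11CensusDistinctCore

/-!
# The catalogue census of §7.3 as kernel facts, IX: the distinct-values machine, part 2 — the `LIN` tuple
generator on a scaled window, with soundness and completeness (cell `pub-ising3x`, seat recog-1; paper §1.6 /
§7.3)

HONEST FRAMING: lottery ticket; floor = tightest certified 3D Ising CFT bounds; no exact-solution
claim without a proof. Island framing: certified exclusion region at stated derivative order and
assumptions; not a determination of the 3D Ising critical exponents beyond that.

* (the unit `distU` and the tagged scaled enclosure `linEncOf` of a `LIN` tuple are in part 1, `…DistinctCore.lean`; the ONE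
  enclosure table of the `LIN` side of this machine is `kZT` / `linZEnclT` = the landed `kZ` / `linZEncl` of `ExclusionSentencesLin`
  with the `log 2` entry read at twenty digits from the landed `LogTwoBounds` — `LIN`–`LIN` separates at the landed ten digits,
  `LIN`–`TRG` does not);
* the `LIN` tuple generator `linTupGen Wlo Whi`: the PRIMITIVE tuples of `linFamily 12` whose scaled value can lie
  in the window `[Wlo, Whi]` (`ℕ` range arithmetic in the shape of part VI's `linWin`, the shift `a₀ + 1024`;
  primitivity = the census machine's `linPrim`), and the two facts the census and covering machines did not need
  together: SOUNDNESS (`linTupGen_sound`: a generated tuple is a primitive tuple of the table, `linTupleOK 12` and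
  `linPrim`, and its enclosure contains `distU·value`) and COMPLETENESS (`linTupGen_complete`: every primitive tuple
  of the table with `distU·value ∈ [Wlo, Whi]` is generated, for `Wlo ≥ 3·10⁹·lcm32`), the latter through one decided
  bound on the landed vector enclosures (`linVecs_bounds`: `|T| ≤ 10²¹`, width `≤ 3·10⁹`) and the range argument of
  the census machine's `lin_a0_mem_range` re-targeted to a window.
Pure arithmetic over landed definitions and certified enclosures; no certificate, no datum, no σ–ε axiom; nothing is
recognised (§1.6); no P(M·) relevance. Python twin (same integers end to end): recog-1 gen 53 `twin.py`.
lottery ticket; floor = tightest certified 3D Ising CFT bounds; no exact-solution claim without a proof.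
-/

namespace Summit.CriticalPhenomena.Ising3D
namespace ColumnFaceL11
open Set Literature.MathematicalPhysics.QuantumFieldTheory.ConformalBootstrap3D

/-! ### Two arithmetic facts used by the generator lemmas -/

/-- Ceiling division bound: `N ≤ m·X` gives `⌈N/m⌉ ≤ X`. [folklore] -/
theorem ceilDiv_le_of_le_mul {N m X : ℕ} (hm : 0 < m) (h : N ≤ m * X) : (N + m - 1) / m ≤ X := by
  have h2 : (N + m - 1) / m < X + 1 := by
    rw [Nat.div_lt_iff_lt_mul hm]
    have e : (X + 1) * m = m * X + m := by ring
    rw [e]; omega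
  omega

/-- Decided bounds on the TIGHT vector enclosures `linZEnclT 0 c` of all 12 264 coefficient vectors of the
table: `−10²¹ ≤ T₁`, `T₂ ≤ 10²¹` (so `|a₀| < 1024` on the segment) and width `T₂ − T₁ ≤ 3·10⁹` (generous: the
tight widths are `≤ 3·10⁶`). [folklore] -/
theorem linVecs_bounds {i : ℕ} (hi : i < 7) {c : List ℤ} (hc : c ∈ linVecsFirst i) :
    -(10 : ℤ) ^ 21 ≤ (linZEnclT 0 c).1 ∧ (linZEnclT 0 c).2 ≤ 10 ^ 21 ∧
      (linZEnclT 0 c).2 - (linZEnclT 0 c).1 ≤ 3 * 10 ^ 9 := by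
  have h : ((List.range 7).all fun i => (linVecsFirst i).all fun c =>
      decide (-(10 : ℤ) ^ 21 ≤ (linZEnclT 0 c).1) && decide ((linZEnclT 0 c).2 ≤ 10 ^ 21) &&
        decide ((linZEnclT 0 c).2 - (linZEnclT 0 c).1 ≤ 3 * 10 ^ 9)) = true := by
    decide +kernel
  simp only [List.all_eq_true, List.mem_range, Bool.and_eq_true, decide_eq_true_eq] at h
  obtain ⟨⟨h1, h2⟩, h3⟩ := h i hi c hc
  exact ⟨h1, h2, h3⟩

/-! ### The `LIN` generator on a scaled window (tuples WITH their enclosures), soundness -/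

/-- The `a₀` shift keeping the range arithmetic in `ℕ` (`|a₀| < 1024` for every tuple with value in the
segment: `|Σ cᵢKᵢ| ≤ 24·π³ < 1000`). [folklore] -/
def linShift : ℕ := 1024

/-- Per-denominator window data, computed once per window: `(aₓ, m, ⌈Wlo/m⌉, ⌊Whi/m⌋)` with `m = lcm32/aₓ`,
`aₓ = 1, …, 12`. [folklore] -/
def linPreW (Wlo Whi : ℕ) : List (ℕ × ℕ × ℕ × ℕ) :=
  (List.range' 1 12).map fun ax : ℕ =>
    (ax, lcm32 / ax, (Wlo + lcm32 / ax - 1) / (lcm32 / ax), Whi / (lcm32 / ax))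

/-- What `linPreW` lists. [folklore] -/
theorem mem_linPreW_iff {Wlo Whi : ℕ} {q : ℕ × ℕ × ℕ × ℕ} : q ∈ linPreW Wlo Whi ↔
    ∃ ax : ℕ, (1 ≤ ax ∧ ax ≤ 12) ∧ q = (ax, lcm32 / ax, (Wlo + lcm32 / ax - 1) / (lcm32 / ax), Whi / (lcm32 / ax)) := by
  unfold linPreW
  rw [List.mem_map]
  constructor
  · rintro ⟨ax, hax, rfl⟩
    rw [List.mem_range'_1] at hax
    exact ⟨ax, by omega, rfl⟩
  · rintro ⟨ax, hax, rfl⟩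
    exact ⟨ax, List.mem_range'_1.mpr (by omega), rfl⟩

/-- Candidates of one coefficient vector `c` (with `T = linZEnclT 0 c`, `T₁' = 1024·10¹⁸ − T₁`, `T₂' = 1024·10¹⁸ − T₂`):
for each denominator datum `(aₓ, m, ⌈Wlo/m⌉, ⌊Whi/m⌋)` the shifted numerators
`a₀ + 1024 ∈ [⌈(⌈Wlo/m⌉ + T₂')/10¹⁸⌉, ⌊(⌊Whi/m⌋ + T₁')/10¹⁸⌋]`, kept when `T₁' ≤ 10¹⁸(a₀ + 1024)` and the tuple is
PRIMITIVE; each emitted WITH its tagged enclosure `((10¹⁸(a₀+1024) − T₁')·m, (10¹⁸(a₀+1024) − T₂')·m, tag)`, `tag = 2` for a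
`TRG` form and `0` otherwise (`= linEncOf`, `linGen_snd`). [folklore] -/
def linGenC (pre : List (ℕ × ℕ × ℕ × ℕ)) (c : List ℤ) : List ((ℤ × List ℤ × ℕ) × Enc) :=
  let T := linZEnclT 0 c
  let g := gcdList c
  let T1' : ℕ := ((linShift : ℤ) * linS - T.1).toNat
  let T2' : ℕ := ((linShift : ℤ) * linS - T.2).toNat
  pre.flatMap fun q =>
    let lo := (q.2.2.1 + T2' + linS - 1) / linS
    let hi := (q.2.2.2 + T1') / linS
    if hi < lo then [] else
      (List.range' lo (hi + 1 - lo)).flatMap fun a0p : ℕ =>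
        if T1' ≤ linS * a0p ∧ Nat.gcd (Nat.gcd ((a0p : ℤ) - linShift).natAbs q.1) g = 1 then
          [(((a0p : ℤ) - linShift, c, q.1), ((linS * a0p - T1') * q.2.1, (linS * a0p - T2') * q.2.1,
            if linIsTrg ((a0p : ℤ) - linShift, c, q.1) then 2 else 0))]
        else []

/-- **The `LIN` generator** on the scaled window `[Wlo, Whi]` (tuples with enclosures) over a LIST OF FIRST-INDEX CLASSES `cls`
of the §7.3 census machine's `linVecsFirst` (the kernel's memory budget takes the mixed chain one class group at a time). [folklore] -/
def linGenG (cls : List ℕ) (Wlo Whi : ℕ) : List ((ℤ × List ℤ × ℕ) × Enc) :=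
  cls.flatMap fun i => (linVecsFirst i).flatMap (linGenC (linPreW Wlo Whi))

/-- All seven classes: exactly the coefficient vectors of the table `linTupleOK 12`. [folklore] -/
def linGen (Wlo Whi : ℕ) : List ((ℤ × List ℤ × ℕ) × Enc) := linGenG (List.range 7) Wlo Whi

/-- The `LIN` tuples of the window, class group `cls`. [folklore] -/
def linTupGenG (cls : List ℕ) (Wlo Whi : ℕ) : List (ℤ × List ℤ × ℕ) := (linGenG cls Wlo Whi).map Prod.fst

/-- The `LIN` tuples of the window. [folklore] -/
def linTupGen (Wlo Whi : ℕ) : List (ℤ × List ℤ × ℕ) := (linGen Wlo Whi).map Prod.fst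

/-- What `linGenC` lists (over the window data `linPreW Wlo Whi`). [folklore] -/
theorem mem_linGenC_iff {Wlo Whi : ℕ} {c : List ℤ} {x : (ℤ × List ℤ × ℕ) × Enc} :
    x ∈ linGenC (linPreW Wlo Whi) c ↔ ∃ (ax a0p : ℕ), (1 ≤ ax ∧ ax ≤ 12) ∧
      (((Wlo + lcm32 / ax - 1) / (lcm32 / ax) + ((linShift : ℤ) * linS - (linZEnclT 0 c).2).toNat +
          linS - 1) / linS ≤ a0p ∧
        a0p ≤ (Whi / (lcm32 / ax) + ((linShift : ℤ) * linS - (linZEnclT 0 c).1).toNat) / linS) ∧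
      ((linShift : ℤ) * linS - (linZEnclT 0 c).1).toNat ≤ linS * a0p ∧
      Nat.gcd (Nat.gcd ((a0p : ℤ) - linShift).natAbs ax) (gcdList c) = 1 ∧
      x = (((a0p : ℤ) - linShift, c, ax),
        ((linS * a0p - ((linShift : ℤ) * linS - (linZEnclT 0 c).1).toNat) * (lcm32 / ax),
          (linS * a0p - ((linShift : ℤ) * linS - (linZEnclT 0 c).2).toNat) * (lcm32 / ax),
          if linIsTrg ((a0p : ℤ) - linShift, c, ax) then 2 else 0)) := by
  unfold linGenC
  simp only [List.mem_flatMap]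
  constructor
  · rintro ⟨q, hq, hx⟩
    obtain ⟨ax, hax, rfl⟩ := mem_linPreW_iff.mp hq
    simp only at hx
    split_ifs at hx with hlt
    · simp at hx
    · rw [List.mem_flatMap] at hx
      obtain ⟨a0p, ha0p, hx⟩ := hx
      rw [List.mem_range'_1] at ha0p
      by_cases hc : ((linShift : ℤ) * linS - (linZEnclT 0 c).1).toNat ≤ linS * a0p ∧
          Nat.gcd (Nat.gcd ((a0p : ℤ) - linShift).natAbs ax) (gcdList c) = 1
      · rw [if_pos hc, List.mem_singleton] at hx
        exact ⟨ax, a0p, hax, by omega, hc.1, hc.2, hx⟩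
      · rw [if_neg hc] at hx; simp at hx
  · rintro ⟨ax, a0p, hax, ha0p, hg1, hg2, rfl⟩
    refine ⟨_, mem_linPreW_iff.mpr ⟨ax, hax, rfl⟩, ?_⟩
    simp only
    rw [if_neg (by omega), List.mem_flatMap]
    refine ⟨a0p, List.mem_range'_1.mpr (by omega), ?_⟩
    rw [if_pos ⟨hg1, hg2⟩, List.mem_singleton]

/-- What `linGenG` lists. [folklore] -/
theorem mem_linGenG_iff {cls : List ℕ} {Wlo Whi : ℕ} {x : (ℤ × List ℤ × ℕ) × Enc} :
    x ∈ linGenG cls Wlo Whi ↔ ∃ i ∈ cls, ∃ c ∈ linVecsFirst i, x ∈ linGenC (linPreW Wlo Whi) c := by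
  unfold linGenG
  simp only [List.mem_flatMap]

/-- What `linGen` lists. [folklore] -/
theorem mem_linGen_iff {Wlo Whi : ℕ} {x : (ℤ × List ℤ × ℕ) × Enc} :
    x ∈ linGen Wlo Whi ↔ ∃ i, i < 7 ∧ ∃ c ∈ linVecsFirst i, x ∈ linGenC (linPreW Wlo Whi) c := by
  unfold linGen
  rw [mem_linGenG_iff]
  simp only [List.mem_range]

/-- The emitted enclosure IS `linEncOf` of the emitted tuple. [folklore] -/
theorem linGenG_snd {cls : List ℕ} (hcls : ∀ i ∈ cls, i < 7) {Wlo Whi : ℕ} {x : (ℤ × List ℤ × ℕ) × Enc}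
    (hx : x ∈ linGenG cls Wlo Whi) : x.2 = linEncOf x.1 := by
  obtain ⟨i, hic, c, hc, hx⟩ := mem_linGenG_iff.mp hx
  have hi : i < 7 := hcls i hic
  obtain ⟨ax, a0p, -, -, hguard, -, rfl⟩ := mem_linGenC_iff.mp hx
  obtain ⟨hB1, hB2, -⟩ := linVecs_bounds hi hc
  obtain ⟨hR1, hR2⟩ := linZEnclT_sound 0 c
  set T := linZEnclT 0 c with hT
  have hT12 : T.1 ≤ T.2 := by exact_mod_cast hR1.trans hR2
  have hS : (linS : ℤ) = 1000000000000000000 := by norm_num [linS]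
  have hSh : (linShift : ℤ) = 1024 := by norm_num [linShift]
  have hT1' : ((((linShift : ℤ) * linS - T.1).toNat : ℕ) : ℤ) = (linShift : ℤ) * linS - T.1 :=
    Int.toNat_of_nonneg (by rw [hS, hSh]; omega)
  have hT2' : ((((linShift : ℤ) * linS - T.2).toNat : ℕ) : ℤ) = (linShift : ℤ) * linS - T.2 :=
    Int.toNat_of_nonneg (by rw [hS, hSh]; omega)
  have hg : ((((linShift : ℤ) * linS - T.1).toNat : ℕ) : ℤ) ≤ ((linS * a0p : ℕ) : ℤ) := by exact_mod_cast hguard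
  have hguard2 : ((linShift : ℤ) * linS - T.2).toNat ≤ linS * a0p := by
    have h : ((((linShift : ℤ) * linS - T.2).toNat : ℕ) : ℤ) ≤ ((linS * a0p : ℕ) : ℤ) := by
      rw [hT2']; rw [hT1'] at hg; linarith
    exact_mod_cast h
  have e1 : (((linS * a0p - ((linShift : ℤ) * linS - T.1).toNat : ℕ) : ℤ)) =
      (linS : ℤ) * ((a0p : ℤ) - linShift) + T.1 := by
    rw [Int.natCast_sub hguard, hT1']; push_cast; ring
  have e2 : (((linS * a0p - ((linShift : ℤ) * linS - T.2).toNat : ℕ) : ℤ)) =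
      (linS : ℤ) * ((a0p : ℤ) - linShift) + T.2 := by
    rw [Int.natCast_sub hguard2, hT2']; push_cast; ring
  have n1 : 0 ≤ (linS : ℤ) * ((a0p : ℤ) - linShift) + T.1 := by rw [← e1]; positivity
  have n2 : 0 ≤ (linS : ℤ) * ((a0p : ℤ) - linShift) + T.2 := by rw [← e2]; positivity
  have c1 : linS * a0p - ((linShift : ℤ) * linS - T.1).toNat = ((linS : ℤ) * ((a0p : ℤ) - linShift) + T.1).toNat := by
    have h : (((linS * a0p - ((linShift : ℤ) * linS - T.1).toNat : ℕ) : ℤ)) =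
        ((((linS : ℤ) * ((a0p : ℤ) - linShift) + T.1).toNat : ℕ) : ℤ) := by rw [e1, Int.toNat_of_nonneg n1]
    exact_mod_cast h
  have c2 : linS * a0p - ((linShift : ℤ) * linS - T.2).toNat = ((linS : ℤ) * ((a0p : ℤ) - linShift) + T.2).toNat := by
    have h : (((linS * a0p - ((linShift : ℤ) * linS - T.2).toNat : ℕ) : ℤ)) =
        ((((linS : ℤ) * ((a0p : ℤ) - linShift) + T.2).toNat : ℕ) : ℤ) := by rw [e2, Int.toNat_of_nonneg n2]
    exact_mod_cast h
  unfold linEncOf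
  simp only [c1, c2]
  rfl

/-- **Soundness of the `LIN` generator**: a generated tuple is a PRIMITIVE tuple of the table `linFamily 12`
(`linTupleOK 12`, `linPrim`), and its enclosure `linEncOf` contains `distU · value`. [folklore] -/
theorem linTupGenG_sound {cls : List ℕ} (hcls : ∀ i ∈ cls, i < 7) {Wlo Whi : ℕ} {e : ℤ × List ℤ × ℕ}
    (he : e ∈ linTupGenG cls Wlo Whi) :
    linTupleOK 12 e = true ∧ linPrim e = true ∧
      (((linEncOf e).1 : ℕ) : ℝ) ≤ (distU : ℝ) * lin7TupleVal e ∧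
        (distU : ℝ) * lin7TupleVal e ≤ (((linEncOf e).2.1 : ℕ) : ℝ) := by
  unfold linTupGenG at he
  rw [List.mem_map] at he
  obtain ⟨x, hx, rfl⟩ := he
  obtain ⟨i, hic, c, hc, hx⟩ := mem_linGenG_iff.mp hx
  have hi : i < 7 := hcls i hic
  obtain ⟨ax, a0p, hax, -, hguard, hgcd, rfl⟩ := mem_linGenC_iff.mp hx
  have hok := linTupleOK_of_mem_linVecsFirst (by omega) hc (a0 := (a0p : ℤ) - linShift) hax.1 hax.2
  have hprim : linPrim ((a0p : ℤ) - linShift, c, ax) = true := by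
    simp only [linPrim, beq_iff_eq]
    exact hgcd
  have hnn : 0 ≤ (linS : ℤ) * ((a0p : ℤ) - linShift) + (linZEnclT 0 c).1 := by
    have h := Int.self_le_toNat ((linShift : ℤ) * linS - (linZEnclT 0 c).1)
    have h' : ((((linShift : ℤ) * linS - (linZEnclT 0 c).1).toNat : ℕ) : ℤ) ≤ (linS : ℤ) * (a0p : ℤ) := by
      exact_mod_cast hguard
    linarith
  exact ⟨hok, hprim, linEncOf_sound hax.1 hax.2 hnn⟩

/-- Class lists inside `range 7`. [folklore] -/
theorem range7_lt : ∀ i ∈ List.range 7, i < 7 := fun _ hi => List.mem_range.mp hi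

/-- Soundness for all classes. [folklore] -/
theorem linTupGen_sound {Wlo Whi : ℕ} {e : ℤ × List ℤ × ℕ} (he : e ∈ linTupGen Wlo Whi) :
    linTupleOK 12 e = true ∧ linPrim e = true ∧
      (((linEncOf e).1 : ℕ) : ℝ) ≤ (distU : ℝ) * lin7TupleVal e ∧
        (distU : ℝ) * lin7TupleVal e ≤ (((linEncOf e).2.1 : ℕ) : ℝ) :=
  linTupGenG_sound range7_lt he

/-- The emitted enclosures are `linEncOf` of the tuples (as lists). [folklore] -/
theorem linGenG_map_snd {cls : List ℕ} (hcls : ∀ i ∈ cls, i < 7) (Wlo Whi : ℕ) :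
    (linGenG cls Wlo Whi).map Prod.snd = (linTupGenG cls Wlo Whi).map linEncOf := by
  unfold linTupGenG
  rw [List.map_map]
  exact List.map_congr_left fun x hx => linGenG_snd hcls hx

/-- All classes. [folklore] -/
theorem linGen_map_snd (Wlo Whi : ℕ) : (linGen Wlo Whi).map Prod.snd = (linTupGen Wlo Whi).map linEncOf :=
  linGenG_map_snd range7_lt Wlo Whi

/-! ### Completeness of the `LIN` generator -/

/-- **Completeness of the `LIN` generator**: on a window with `Wlo ≥ 3·10⁹·lcm32` (true for every window inside
the segment, whose scaled left end is `≈ 1.8·10³²`), every PRIMITIVE tuple of the table `linFamily 12` whose scaled value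
`distU · value` lies in `[Wlo, Whi]` is generated. [folklore] -/
theorem linTupGenG_complete {cls : List ℕ} {Wlo Whi : ℕ} (hW : 3 * 10 ^ 9 * lcm32 ≤ Wlo) {e : ℤ × List ℤ × ℕ}
    (hok : linTupleOK 12 e = true) (hprim : linPrim e = true) (hcl : firstNZ e.2.1 ∈ cls)
    (hlo : (Wlo : ℝ) ≤ (distU : ℝ) * lin7TupleVal e) (hhi : (distU : ℝ) * lin7TupleVal e ≤ (Whi : ℝ)) :
    e ∈ linTupGenG cls Wlo Whi := by
  obtain ⟨i, hi, hc, hax1, hax2⟩ := exists_mem_linVecsFirst_of_linTupleOK hok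
  obtain ⟨a0, c, ax⟩ := e
  simp only at hc hax1 hax2 hlo hhi hcl
  have hic : i ∈ cls := by rw [← firstNZ_of_mem_linVecsFirst hc]; exact hcl
  obtain ⟨hB1, hB2, hB3⟩ := linVecs_bounds (by omega) hc
  obtain ⟨hT1, hT2⟩ := linZEnclT_sound 0 c
  set T := linZEnclT 0 c with hT
  set m : ℕ := lcm32 / ax with hm
  have hmax : m * ax = lcm32 := Nat.div_mul_cancel (dvd_lcm32_of_le_12 hax1 hax2)
  have hm1 : 1 ≤ m := by
    rcases Nat.eq_zero_or_pos m with h0 | h0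
    · rw [h0, zero_mul] at hmax; unfold lcm32 at hmax; omega
    · exact h0
  have hmle : m ≤ lcm32 := by rw [hm]; exact Nat.div_le_self _ _
  have key := distU_mul_linVal a0 c hax1 hax2
  rw [key] at hlo hhi
  have hm0 : (0 : ℝ) ≤ m := by positivity
  have i1 : (Wlo : ℤ) ≤ (m : ℤ) * ((linS : ℤ) * a0 + T.2) := by
    have h : (Wlo : ℝ) ≤ (m : ℝ) * ((linS : ℝ) * a0 + (T.2 : ℝ)) :=
      hlo.trans (by nlinarith [mul_le_mul_of_nonneg_left hT2 hm0])
    exact_mod_cast h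
  have i2 : (m : ℤ) * ((linS : ℤ) * a0 + T.1) ≤ (Whi : ℤ) := by
    have h : (m : ℝ) * ((linS : ℝ) * a0 + (T.1 : ℝ)) ≤ (Whi : ℝ) :=
      le_trans (by nlinarith [mul_le_mul_of_nonneg_left hT1 hm0]) hhi
    exact_mod_cast h
  have hWm : (3 * 10 ^ 9 : ℤ) * m ≤ (Wlo : ℤ) := by
    have : 3 * 10 ^ 9 * m ≤ Wlo := le_trans (Nat.mul_le_mul_left _ hmle) hW
    exact_mod_cast this
  have hm1' : (0 : ℤ) < m := by exact_mod_cast hm1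
  have hX2 : (3 * 10 ^ 9 : ℤ) ≤ (linS : ℤ) * a0 + T.2 := by
    have h : (m : ℤ) * (3 * 10 ^ 9) ≤ (m : ℤ) * ((linS : ℤ) * a0 + T.2) := by linarith
    exact le_of_mul_le_mul_left h hm1'
  have hX1 : (0 : ℤ) ≤ (linS : ℤ) * a0 + T.1 := by linarith
  have hT12 : T.1 ≤ T.2 := by
    have h : (T.1 : ℝ) ≤ T.2 := hT1.trans hT2
    exact_mod_cast h
  have hS : (linS : ℤ) = 1000000000000000000 := by norm_num [linS]
  have hSh : (linShift : ℤ) = 1024 := by norm_num [linShift]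
  have ha0 : (0 : ℤ) ≤ a0 + linShift := by
    have h : -(10 : ℤ) ^ 21 ≤ (linS : ℤ) * a0 := by linarith
    rw [hS] at h; rw [hSh]; omega
  -- the shifted numerator, the scaled ends, the two non-negative shifts (as naturals with their casts)
  obtain ⟨a0p, ha0p⟩ : ∃ a0p : ℕ, (a0p : ℤ) = a0 + linShift :=
    ⟨(a0 + linShift).toNat, Int.toNat_of_nonneg ha0⟩
  obtain ⟨X1, hX1e⟩ : ∃ X1 : ℕ, (X1 : ℤ) = (linS : ℤ) * a0 + T.1 := ⟨_, Int.toNat_of_nonneg hX1⟩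
  obtain ⟨X2, hX2e⟩ : ∃ X2 : ℕ, (X2 : ℤ) = (linS : ℤ) * a0 + T.2 := ⟨_, Int.toNat_of_nonneg (by linarith)⟩
  have hT1' : ((((linShift : ℤ) * linS - T.1).toNat : ℕ) : ℤ) = (linShift : ℤ) * linS - T.1 :=
    Int.toNat_of_nonneg (by rw [hS, hSh]; omega)
  have hT2' : ((((linShift : ℤ) * linS - T.2).toNat : ℕ) : ℤ) = (linShift : ℤ) * linS - T.2 :=
    Int.toNat_of_nonneg (by rw [hS, hSh]; omega)
  have n1 : Wlo ≤ m * X2 := by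
    have h : ((Wlo : ℕ) : ℤ) ≤ ((m * X2 : ℕ) : ℤ) := by push_cast; rw [hX2e]; exact i1
    exact_mod_cast h
  have n2 : m * X1 ≤ Whi := by
    have h : ((m * X1 : ℕ) : ℤ) ≤ ((Whi : ℕ) : ℤ) := by push_cast; rw [hX1e]; exact i2
    exact_mod_cast h
  have e2n : linS * a0p = X2 + ((linShift : ℤ) * linS - T.2).toNat := by
    have h : ((linS * a0p : ℕ) : ℤ) = ((X2 + ((linShift : ℤ) * linS - T.2).toNat : ℕ) : ℤ) := by
      push_cast; rw [ha0p, hX2e, hT2']; ring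
    exact_mod_cast h
  have e1n : a0p * linS = X1 + ((linShift : ℤ) * linS - T.1).toNat := by
    have h : ((a0p * linS : ℕ) : ℤ) = ((X1 + ((linShift : ℤ) * linS - T.1).toNat : ℕ) : ℤ) := by
      push_cast; rw [ha0p, hX1e, hT1']; ring
    exact_mod_cast h
  have hS0 : 0 < linS := by norm_num [linS]
  unfold linTupGenG
  rw [List.mem_map]
  refine ⟨_, mem_linGenG_iff.mpr ⟨i, hic, c, hc,
    mem_linGenC_iff.mpr ⟨ax, a0p, ⟨hax1, hax2⟩, ⟨?_, ?_⟩, ?_, ?_, rfl⟩⟩, ?_⟩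
  · -- lower end of the a₀ range
    rw [← hm, ← hT]
    apply ceilDiv_le_of_le_mul hS0
    have h1 : (Wlo + m - 1) / m ≤ X2 := ceilDiv_le_of_le_mul hm1 n1
    rw [e2n]; omega
  · -- upper end of the a₀ range
    rw [← hm, ← hT, Nat.le_div_iff_mul_le hS0, e1n]
    have h2 : X1 ≤ Whi / m := (Nat.le_div_iff_mul_le hm1).mpr (by rw [mul_comm]; exact n2)
    omega
  · -- the non-negativity guard
    rw [← hT]
    have h : ((((linShift : ℤ) * linS - T.1).toNat : ℕ) : ℤ) ≤ ((linS * a0p : ℕ) : ℤ) := by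
      rw [hT1']; push_cast; rw [ha0p]; linarith
    exact_mod_cast h
  · -- primitivity
    have ha : (a0p : ℤ) - linShift = a0 := by rw [ha0p]; ring
    rw [ha]
    simpa [linPrim] using hprim
  · have ha : (a0p : ℤ) - linShift = a0 := by rw [ha0p]; ring
    rw [ha]

/-- **Completeness for all classes.** [folklore] -/
theorem linTupGen_complete {Wlo Whi : ℕ} (hW : 3 * 10 ^ 9 * lcm32 ≤ Wlo) {e : ℤ × List ℤ × ℕ}
    (hok : linTupleOK 12 e = true) (hprim : linPrim e = true)
    (hlo : (Wlo : ℝ) ≤ (distU : ℝ) * lin7TupleVal e) (hhi : (distU : ℝ) * lin7TupleVal e ≤ (Whi : ℝ)) :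
    e ∈ linTupGen Wlo Whi := by
  obtain ⟨i, hi, hc, -, -⟩ := exists_mem_linVecsFirst_of_linTupleOK hok
  have hcl : firstNZ e.2.1 ∈ List.range 7 := by
    rw [firstNZ_of_mem_linVecsFirst hc]; exact List.mem_range.mpr (by omega)
  exact linTupGenG_complete hW hok hprim hcl hlo hhi

end ColumnFaceL11
end Summit.CriticalPhenomena.Ising3D
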